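import Summits.QuantumFields.YangMills.Theorems.UnitScaleTiltProp7LiftOfRSEqPrintProjector
import Summits.QuantumFields.YangMills.Theorems.UnitScaleTiltProp7NSIntertwinerOfRecord
import Summits.QuantumFields.YangMills.Theorems.UnitScaleTiltProp7SectET3CurvedPropagatorsT3
import Summits.QuantumFields.YangMills.Theorems.UnitScaleTiltProp7SectET3WilsonHessianT3
import Literature.MathematicalPhysics.QuantumFieldTheory.Balaban1983to89.T3PrintedMinimiserExistence
import HarnessLib

/-!
# Route `UnitScaleTilt`, crux K1 «MinimiserStabilityRegPr» (stmt-QuantumFields-19200), EX row `hGF` (curved member), LOD ∕ Combes–Thomas line (★★OWNER RULINGS №33–№35) —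
# **THE γ-ROW DOOR OF THE LINE: the curved target `T_U(A) ≥ γ‖A‖²` (LOCATE-L6-ASSEMBLY §0) at a printed-regular background IMPLIES the displayed gauge-fixed row
# `hGF[Lift]` of S44ᴸγ at that member — one `obtain` (the `Q″` of record) and one `rw` (the Lift identity `R_S = projR (Δ^η_{U₀}) Q″`).**

Fleet seat ★`ym-ust-19200-p1` (gen 24, chair of the 19200 positivity knit, lead of the LOD line).  THEOREMS ONLY (0 `def`, 0 `sorry`); `--supports stmt-QuantumFields-19200
--as helper`, count-neutral.  Letters = w5 g13's ✓`Prop7FlatTargetOfLODLine` (Step I.3) VERBATIM (`DeltaEta`, `projR (covLapSite U₀) Q″`, `DstarL2`, `Qk`, `RS`, `NS`), so the (L6)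
assembler's OUTPUT binder (`hT` below, quantified over every top nested mean `Q″` with clauses (iii) `htop` and (v) `hker` of ✓`Prop7NSIntertwinerOfRecord.exists_intertwiner_of_regPr`)
and its flat INPUT (✓`flat_target_topMean`) have the same shape, and the line's last step is fixed in Lean before the assembly lands.

WHAT IS PROVED (ns `…Theorems.Prop7GaugeFixedRowDoorOfLODTarget`).
* ★ `norm_projR_DstarL2_eq_zero_of_lift` — at `RegPr F n K ε₀ U₀`, `0 < ε₀`, `10¹²L³ε₀ ≤ 1`, for the `Q″` of record and a background on the Lift locus:
  `R_S(U₀)(D*_{U₀}A) = 0 → projR (covLapSite U₀) Q″ (D*_{U₀}A) = 0` (✓`RS_eq_projR_iff_lift`).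
* ★★★ `gaugeFixedRow_of_curvedTarget` — **THE DOOR**: if the curved target holds at `U₀` for every `Q″` of record,
  `hT : ∀ Q″, htop → hker → ∀ A, γ‖A‖² ≤ re⟪A, Δ^η(U₀)A⟫ + ‖projR (covLapSite U₀) Q″ (D*_{U₀}A)‖² + a‖Q_k(U₀)A‖²`,
  then ON THE LIFT LOCUS the displayed row holds: `∀ A, R_S(U₀)(D*_{U₀}A) = 0 → γ‖A‖² ≤ re⟪A, Δ^η(U₀)A⟫ + a‖Q_k(U₀)A‖²` — the `hGF[Lift]` binder text of
  ✓`UnitScaleTiltMinimiserStabilityRegPrOfEXRowsS44LG` at the member `(F, n, K)`, weights `(c₀, cB)`, coupling `a`, window `ε₀ = ρ ≤ αcap L` (`10¹²L³·αcap L ≤ 1`).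
* ★ `gaugeFixedRow_of_curvedTarget_mono` — the same with the target assumed at a larger regularity `ε₁ ≥ ε₀` (`RegPr` is monotone), so the assembler may prove `hT` once at
  `ε₁ := αcap L`.

HONEST SCOPE.  A door (bookkeeping over landed theorems); the curved target `hT` is the (L6) assembly's output and is NOT proved here; nothing of (3.49), Thm 3.3∕3.11, `h349`,
`hGF`, EX or the crux is proved.  Rung R3 — NOT d = 4, NOT infinite volume, NOT a mass gap, NOT Clay.

References: T. Bałaban, CMP **99** (1985) 389–434 [Balaban1985BackgroundPropagators] ((3.20)–(3.27) pp.394–395, Thm 3.3 p.398, Thm 3.11 p.416, (3.115) p.418);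
CMP **95** (1984) 17–40 [Balaban1984PropagatorsI] (Prop. 1.1 (1.90) p.33).
-/

set_option autoImplicit false

noncomputable section

open scoped InnerProductSpace ComplexConjugate Matrix.Norms.L2Operator BigOperators

namespace Summit.QuantumFields.YangMills.Theorems.Prop7GaugeFixedRowDoorOfLODTarget

open Literature.MathematicalPhysics.QuantumFieldTheory.Balaban1983to89
open Literature.MathematicalPhysics.QuantumFieldTheory.Balaban1983to89.T3ContinuumYM3Torus
open T4Continuum BlockAveraging
open BlockAveraging (Idx)
open B7Prop1Explicit (disp)
open B10Eq27TorusAxialLog (holT transl)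
open B7TransferAnalyticMean (meanCLM)
open B11Eq103H1Complex (SiteL2K BondL2K projR)
open B15DeterminingSets (embIter)
open Summit.QuantumFields.YangMills.Theorems.Prop8Chart (emlIterU)
open T3PrintedRegularMinimiser (RegPr)
open T3PrintedMinimiserExistence (regPr_mono)
open T3SectALandauChart (bgUnits)
open Summit.QuantumFields.YangMills.Theorems.Prop7SectET3Transport (periodsT3)
open Summit.QuantumFields.YangMills.Theorems.Prop7SectET3HilbertLetters (W₂ toL2S DL2 DstarL2 covLapSite)
open Summit.QuantumFields.YangMills.Theorems.Prop7SectET3GaugeProjector (NS RS)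
open Summit.QuantumFields.YangMills.Theorems.Prop7SectET3WilsonHessian (DeltaEta)
open Summit.QuantumFields.YangMills.Theorems.Prop7SectET3CurvedPropagators (Qk)
open Summit.QuantumFields.YangMills.Theorems.Prop7LiftOfRSEqPrintProjector (RS_eq_projR_iff_lift)
open Summit.QuantumFields.YangMills.Theorems.Prop7NSIntertwinerOfRecord (exists_intertwiner_of_regPr)

variable {F : T3Family} {n K : ℕ} (h : n ≤ K) {c₀ : ℝ} [Fact (0 < c₀)] (cB : ℝ) [Fact (0 < cB)]

omit [Fact (0 < cB)] in
/-- ★ On the Lift locus, the slice condition `R_S(U₀)(D*_{U₀}A) = 0` kills print's residual-gauge term in the `projR … Q″` letter for the `Q″` OF RECORD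
(any `Q″` with clauses (iii) `htop` and (v) `hker`): `projR (covLapSite U₀) Q″ (D*_{U₀}A) = 0`. [cite: Balaban1985BackgroundPropagators, (3.20)–(3.23) p.394, (3.115) p.418] -/
theorem projR_DstarL2_eq_zero_of_lift {ε₀ : ℝ} (hε₀ : 0 < ε₀) (hWε : 10 ^ 12 * (F.L : ℝ) ^ 3 * ε₀ ≤ 1)
    (U₀ : GaugeField (F.P K) 0 (Matrix.specialUnitaryGroup (Fin 2) ℂ)) (hreg : RegPr F n K ε₀ U₀)
    (Q'' : SiteL2K ℂ 3 (periodsT3 F K) c₀ W₂ →ₗ[ℂ] (Site (F.P K) (K - n) → Matrix (Fin 2) (Fin 2) ℂ))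
    (htop : ∀ (lam : Site (F.P K) 0 → Matrix (Fin 2) (Fin 2) ℂ) (ns : (j : ℕ) → Site (F.P K) j → Matrix (Fin 2) (Fin 2) ℂ), ns 0 = lam →
      (∀ (j : ℕ) (y : Site (F.P K) (j + 1)), ns (j + 1) y = ns j (emb y) - meanCLM (Idx (F.P K)) (Matrix (Fin 2) (Fin 2) ℂ) fun i : Idx (F.P K) =>
        ns j (emb y) - ((holT (emlIterU j (bgUnits F K U₀)) (emb y) (stairWord i.2.1 (off i.1)) : (Matrix (Fin 2) (Fin 2) ℂ)ˣ) : Matrix (Fin 2) (Fin 2) ℂ) *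
          ns j (transl (emb y) (disp (stairWord i.2.1 (off i.1)))) * (((holT (emlIterU j (bgUnits F K U₀)) (emb y) (stairWord i.2.1 (off i.1)))⁻¹ : (Matrix (Fin 2) (Fin 2) ℂ)ˣ) : Matrix (Fin 2) (Fin 2) ℂ)) →
      ns (K - n) = Q'' (toL2S F K c₀ lam))
    (hker : LinearMap.ker Q'' ≤ NS F n K h c₀ cB U₀)
    (hlift : ∀ cf : Site (F.P K) (K - n) → Matrix (Fin 2) (Fin 2) ℂ,
        (∀ e : PBond (F.P K) (K - n), cf e.src = ((emlIterU (K - n) (bgUnits F K U₀) e : (Matrix (Fin 2) (Fin 2) ℂ)ˣ) : Matrix (Fin 2) (Fin 2) ℂ) * cf e.tgt *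
          (((emlIterU (K - n) (bgUnits F K U₀) e)⁻¹ : (Matrix (Fin 2) (Fin 2) ℂ)ˣ) : Matrix (Fin 2) (Fin 2) ℂ)) →
        ∃ l₀ : Site (F.P K) 0 → Matrix (Fin 2) (Fin 2) ℂ,
          (∀ b : PBond (F.P K) 0, l₀ b.src = ((bgUnits F K U₀ b : (Matrix (Fin 2) (Fin 2) ℂ)ˣ) : Matrix (Fin 2) (Fin 2) ℂ) * l₀ b.tgt * (((bgUnits F K U₀ b)⁻¹ : (Matrix (Fin 2) (Fin 2) ℂ)ˣ) : Matrix (Fin 2) (Fin 2) ℂ)) ∧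
          ∀ y : Site (F.P K) (K - n), l₀ (embIter (K - n) y) = cf y)
    (A : BondL2K ℂ 3 (periodsT3 F K) c₀ W₂) (hA : RS F n K h c₀ cB U₀ (DstarL2 F n K c₀ U₀ A) = 0) :
    projR (covLapSite F n K c₀ U₀) Q'' (DstarL2 F n K c₀ U₀ A) = 0 := by
  rw [← (RS_eq_projR_iff_lift (F := F) h cB hε₀ hWε U₀ hreg Q'' htop hker).2 hlift]
  exact hA

/-- ★★★ **THE γ-ROW DOOR OF THE LOD LINE.**  At a printed-regular background `U₀` (`RegPr F n K ε₀ U₀`, `0 < ε₀`, `10¹²L³ε₀ ≤ 1`): if the CURVED TARGET of LOCATE-L6-ASSEMBLY §0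
holds for every top nested mean `Q″` of record (`hT`, the (L6) assembly's output, same shape as ✓`Prop7FlatTargetOfLODLine.flat_target_topMean`), then the displayed gauge-fixed
row holds ON THE LIFT LOCUS: `∀ A, R_S(U₀)(D*_{U₀}A) = 0 → γ‖A‖² ≤ re⟪A, Δ^η(U₀)A⟫ + a‖Q_k(U₀)A‖²` — the `hGF[Lift]` binder of S44ᴸγ at the member.
PROOF: take the `Q″` of record (✓`exists_intertwiner_of_regPr`, clauses (iii),(v)), apply `hT`, and kill the residual-gauge term by `projR_DstarL2_eq_zero_of_lift`.
[cite: Balaban1985BackgroundPropagators, Thm 3.3 p.398, Thm 3.11 p.416, (3.20)–(3.27) pp.394–395] -/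
theorem gaugeFixedRow_of_curvedTarget {ε₀ : ℝ} (hε₀ : 0 < ε₀) (hWε : 10 ^ 12 * (F.L : ℝ) ^ 3 * ε₀ ≤ 1)
    (U₀ : GaugeField (F.P K) 0 (Matrix.specialUnitaryGroup (Fin 2) ℂ)) (hreg : RegPr F n K ε₀ U₀) {γ a : ℝ}
    (hT : ∀ (Q'' : SiteL2K ℂ 3 (periodsT3 F K) c₀ W₂ →ₗ[ℂ] (Site (F.P K) (K - n) → Matrix (Fin 2) (Fin 2) ℂ)),
      (∀ (lam : Site (F.P K) 0 → Matrix (Fin 2) (Fin 2) ℂ) (ns : (j : ℕ) → Site (F.P K) j → Matrix (Fin 2) (Fin 2) ℂ), ns 0 = lam →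
        (∀ (j : ℕ) (y : Site (F.P K) (j + 1)), ns (j + 1) y = ns j (emb y) - meanCLM (Idx (F.P K)) (Matrix (Fin 2) (Fin 2) ℂ) fun i : Idx (F.P K) =>
          ns j (emb y) - ((holT (emlIterU j (bgUnits F K U₀)) (emb y) (stairWord i.2.1 (off i.1)) : (Matrix (Fin 2) (Fin 2) ℂ)ˣ) : Matrix (Fin 2) (Fin 2) ℂ) *
            ns j (transl (emb y) (disp (stairWord i.2.1 (off i.1)))) * (((holT (emlIterU j (bgUnits F K U₀)) (emb y) (stairWord i.2.1 (off i.1)))⁻¹ : (Matrix (Fin 2) (Fin 2) ℂ)ˣ) : Matrix (Fin 2) (Fin 2) ℂ)) →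
        ns (K - n) = Q'' (toL2S F K c₀ lam)) →
      LinearMap.ker Q'' ≤ NS F n K h c₀ cB U₀ →
      ∀ A : BondL2K ℂ 3 (periodsT3 F K) c₀ W₂,
        γ * ‖A‖ ^ 2 ≤ RCLike.re ⟪A, DeltaEta F n K c₀ U₀ A⟫_ℂ
          + ‖projR (covLapSite F n K c₀ U₀) Q'' (DstarL2 F n K c₀ U₀ A)‖ ^ 2 + a * ‖Qk F n K h c₀ cB U₀ A‖ ^ 2)
    (hlift : ∀ cf : Site (F.P K) (K - n) → Matrix (Fin 2) (Fin 2) ℂ,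
        (∀ e : PBond (F.P K) (K - n), cf e.src = ((emlIterU (K - n) (bgUnits F K U₀) e : (Matrix (Fin 2) (Fin 2) ℂ)ˣ) : Matrix (Fin 2) (Fin 2) ℂ) * cf e.tgt *
          (((emlIterU (K - n) (bgUnits F K U₀) e)⁻¹ : (Matrix (Fin 2) (Fin 2) ℂ)ˣ) : Matrix (Fin 2) (Fin 2) ℂ)) →
        ∃ l₀ : Site (F.P K) 0 → Matrix (Fin 2) (Fin 2) ℂ,
          (∀ b : PBond (F.P K) 0, l₀ b.src = ((bgUnits F K U₀ b : (Matrix (Fin 2) (Fin 2) ℂ)ˣ) : Matrix (Fin 2) (Fin 2) ℂ) * l₀ b.tgt * (((bgUnits F K U₀ b)⁻¹ : (Matrix (Fin 2) (Fin 2) ℂ)ˣ) : Matrix (Fin 2) (Fin 2) ℂ)) ∧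
          ∀ y : Site (F.P K) (K - n), l₀ (embIter (K - n) y) = cf y)
    (A : BondL2K ℂ 3 (periodsT3 F K) c₀ W₂) (hA : RS F n K h c₀ cB U₀ (DstarL2 F n K c₀ U₀ A) = 0) :
    γ * ‖A‖ ^ 2 ≤ RCLike.re ⟪A, DeltaEta F n K c₀ U₀ A⟫_ℂ + a * ‖Qk F n K h c₀ cB U₀ A‖ ^ 2 := by
  obtain ⟨Q'', _D', _hint, _hD', htop, _hseq, hker⟩ := exists_intertwiner_of_regPr (F := F) (c₀ := c₀) h cB hε₀ hWε U₀ hreg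
  have h0 := projR_DstarL2_eq_zero_of_lift h cB hε₀ hWε U₀ hreg Q'' htop hker hlift A hA
  have h1 := hT Q'' htop hker A
  rw [h0, norm_zero, zero_pow two_ne_zero, add_zero] at h1
  exact h1

/-- ★ **THE DOOR AT THE CAP**: the curved target assumed ONCE at a larger regularity parameter `ε₁` (`ε₀ ≤ ε₁`, `10¹²L³ε₁ ≤ 1`; the (L6) assembler proves `hT` at
`ε₁ := αcap L`) serves every `RegPr ε₀ U₀` with `0 < ε₀ ≤ ε₁` — `RegPr` is monotone (lit ✓`T3PrintedMinimiserExistence.regPr_mono`).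
[cite: Balaban1985BackgroundPropagators, (3.1)–(3.2) p.390, Thm 3.3 p.398] -/
theorem gaugeFixedRow_of_curvedTarget_of_le {ε₀ ε₁ : ℝ} (hε₀ : 0 < ε₀) (hε : ε₀ ≤ ε₁) (hWε : 10 ^ 12 * (F.L : ℝ) ^ 3 * ε₁ ≤ 1)
    (U₀ : GaugeField (F.P K) 0 (Matrix.specialUnitaryGroup (Fin 2) ℂ)) (hreg : RegPr F n K ε₀ U₀) {γ a : ℝ}
    (hT : ∀ (Q'' : SiteL2K ℂ 3 (periodsT3 F K) c₀ W₂ →ₗ[ℂ] (Site (F.P K) (K - n) → Matrix (Fin 2) (Fin 2) ℂ)),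
      (∀ (lam : Site (F.P K) 0 → Matrix (Fin 2) (Fin 2) ℂ) (ns : (j : ℕ) → Site (F.P K) j → Matrix (Fin 2) (Fin 2) ℂ), ns 0 = lam →
        (∀ (j : ℕ) (y : Site (F.P K) (j + 1)), ns (j + 1) y = ns j (emb y) - meanCLM (Idx (F.P K)) (Matrix (Fin 2) (Fin 2) ℂ) fun i : Idx (F.P K) =>
          ns j (emb y) - ((holT (emlIterU j (bgUnits F K U₀)) (emb y) (stairWord i.2.1 (off i.1)) : (Matrix (Fin 2) (Fin 2) ℂ)ˣ) : Matrix (Fin 2) (Fin 2) ℂ) *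
            ns j (transl (emb y) (disp (stairWord i.2.1 (off i.1)))) * (((holT (emlIterU j (bgUnits F K U₀)) (emb y) (stairWord i.2.1 (off i.1)))⁻¹ : (Matrix (Fin 2) (Fin 2) ℂ)ˣ) : Matrix (Fin 2) (Fin 2) ℂ)) →
        ns (K - n) = Q'' (toL2S F K c₀ lam)) →
      LinearMap.ker Q'' ≤ NS F n K h c₀ cB U₀ →
      ∀ A : BondL2K ℂ 3 (periodsT3 F K) c₀ W₂,
        γ * ‖A‖ ^ 2 ≤ RCLike.re ⟪A, DeltaEta F n K c₀ U₀ A⟫_ℂ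
          + ‖projR (covLapSite F n K c₀ U₀) Q'' (DstarL2 F n K c₀ U₀ A)‖ ^ 2 + a * ‖Qk F n K h c₀ cB U₀ A‖ ^ 2)
    (hlift : ∀ cf : Site (F.P K) (K - n) → Matrix (Fin 2) (Fin 2) ℂ,
        (∀ e : PBond (F.P K) (K - n), cf e.src = ((emlIterU (K - n) (bgUnits F K U₀) e : (Matrix (Fin 2) (Fin 2) ℂ)ˣ) : Matrix (Fin 2) (Fin 2) ℂ) * cf e.tgt *
          (((emlIterU (K - n) (bgUnits F K U₀) e)⁻¹ : (Matrix (Fin 2) (Fin 2) ℂ)ˣ) : Matrix (Fin 2) (Fin 2) ℂ)) →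
        ∃ l₀ : Site (F.P K) 0 → Matrix (Fin 2) (Fin 2) ℂ,
          (∀ b : PBond (F.P K) 0, l₀ b.src = ((bgUnits F K U₀ b : (Matrix (Fin 2) (Fin 2) ℂ)ˣ) : Matrix (Fin 2) (Fin 2) ℂ) * l₀ b.tgt * (((bgUnits F K U₀ b)⁻¹ : (Matrix (Fin 2) (Fin 2) ℂ)ˣ) : Matrix (Fin 2) (Fin 2) ℂ)) ∧
          ∀ y : Site (F.P K) (K - n), l₀ (embIter (K - n) y) = cf y)
    (A : BondL2K ℂ 3 (periodsT3 F K) c₀ W₂) (hA : RS F n K h c₀ cB U₀ (DstarL2 F n K c₀ U₀ A) = 0) :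
    γ * ‖A‖ ^ 2 ≤ RCLike.re ⟪A, DeltaEta F n K c₀ U₀ A⟫_ℂ + a * ‖Qk F n K h c₀ cB U₀ A‖ ^ 2 :=
  gaugeFixedRow_of_curvedTarget h cB (lt_of_lt_of_le hε₀ hε) hWε U₀ (regPr_mono (F := F) hε hreg) hT hlift A hA


/-! ## §2 The door at the display's index (`T3Thm1Carrier.Idx L`): the `hGF` binder of S44ᴸγ VERBATIM -/

/-- ★★★ **THE γ-ROW DOOR AT THE DISPLAY'S INDEX — conclusion = the `hGF` binder text of ✓`UnitScaleTiltMinimiserStabilityRegPrOfEXRowsS44LG.minimiserStabilityRegPr_of_EXrowsS44LG`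
VERBATIM** (letters `αcap c₀ cB a γ`, index `i : T3Thm1Carrier.Idx L` = `(F, n, K)` with `F.L = L`, `n < K`): if the (L6) assembly proves the curved target `hT` at the cap
`RegPr (αcap L) U₀` for every member and every top nested mean of record, and the cap obeys the window `10¹²L³·αcap L ≤ 1`, then `hGF` holds as displayed (for every
`ρ ≤ αcap L`, by monotonicity of `RegPr`). [cite: Balaban1985BackgroundPropagators, Thm 3.3 p.398, Thm 3.11 p.416, (3.118)–(3.122) pp.419–420] -/
theorem gaugeFixedRow_idx_of_curvedTarget (αcap : ℕ → ℝ) (hαcap : ∀ L : ℕ, 1 < L → 0 < αcap L)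
    (hWα : ∀ L : ℕ, 1 < L → 10 ^ 12 * (L : ℝ) ^ 3 * αcap L ≤ 1)
    (c₀ cB : ℕ → ℝ) [hc₀ : ∀ L : ℕ, Fact (0 < c₀ L)] [hcB : ∀ L : ℕ, Fact (0 < cB L)] (a : ∀ L : ℕ, T3Thm1Carrier.Idx L → ℝ) (γ : ℕ → ℝ)
    (hT : ∀ (L : ℕ), 1 < L → ∀ (i : T3Thm1Carrier.Idx L) (U₀ : GaugeField (i.1.1.P i.1.2.2) 0 (Matrix.specialUnitaryGroup (Fin 2) ℂ)),
      RegPr i.1.1 i.1.2.1 i.1.2.2 (αcap L) U₀ →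
      ∀ (Q'' : SiteL2K ℂ 3 (periodsT3 i.1.1 i.1.2.2) (c₀ L) W₂ →ₗ[ℂ] (Site (i.1.1.P i.1.2.2) (i.1.2.2 - i.1.2.1) → Matrix (Fin 2) (Fin 2) ℂ)),
        (∀ (lam : Site (i.1.1.P i.1.2.2) 0 → Matrix (Fin 2) (Fin 2) ℂ) (ns : (j : ℕ) → Site (i.1.1.P i.1.2.2) j → Matrix (Fin 2) (Fin 2) ℂ), ns 0 = lam →
          (∀ (j : ℕ) (y : Site (i.1.1.P i.1.2.2) (j + 1)), ns (j + 1) y = ns j (emb y) - meanCLM (Idx (i.1.1.P i.1.2.2)) (Matrix (Fin 2) (Fin 2) ℂ) fun ι : Idx (i.1.1.P i.1.2.2) =>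
            ns j (emb y) - ((holT (emlIterU j (bgUnits i.1.1 i.1.2.2 U₀)) (emb y) (stairWord ι.2.1 (off ι.1)) : (Matrix (Fin 2) (Fin 2) ℂ)ˣ) : Matrix (Fin 2) (Fin 2) ℂ) *
              ns j (transl (emb y) (disp (stairWord ι.2.1 (off ι.1)))) * (((holT (emlIterU j (bgUnits i.1.1 i.1.2.2 U₀)) (emb y) (stairWord ι.2.1 (off ι.1)))⁻¹ : (Matrix (Fin 2) (Fin 2) ℂ)ˣ) : Matrix (Fin 2) (Fin 2) ℂ)) →
          ns (i.1.2.2 - i.1.2.1) = Q'' (toL2S i.1.1 i.1.2.2 (c₀ L) lam)) →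
        LinearMap.ker Q'' ≤ NS i.1.1 i.1.2.1 i.1.2.2 i.2.2.le (c₀ L) (cB L) U₀ →
        ∀ A : BondL2K ℂ 3 (periodsT3 i.1.1 i.1.2.2) (c₀ L) W₂,
          γ L * ‖A‖ ^ 2 ≤ RCLike.re ⟪A, DeltaEta i.1.1 i.1.2.1 i.1.2.2 (c₀ L) U₀ A⟫_ℂ
            + ‖projR (covLapSite i.1.1 i.1.2.1 i.1.2.2 (c₀ L) U₀) Q'' (DstarL2 i.1.1 i.1.2.1 i.1.2.2 (c₀ L) U₀ A)‖ ^ 2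
            + a L i * ‖Qk i.1.1 i.1.2.1 i.1.2.2 i.2.2.le (c₀ L) (cB L) U₀ A‖ ^ 2) :
    ∀ (L : ℕ), 1 < L → ∀ (i : T3Thm1Carrier.Idx L) (U₀ : GaugeField (i.1.1.P i.1.2.2) 0 (Matrix.specialUnitaryGroup (Fin 2) ℂ)), ∀ ρ : ℝ, RegPr i.1.1 i.1.2.1 i.1.2.2 ρ U₀ → ρ ≤ αcap L →
        (∀ cf : Site (i.1.1.P i.1.2.2) (i.1.2.2 - i.1.2.1) → Matrix (Fin 2) (Fin 2) ℂ,
        (∀ e' : PBond (i.1.1.P i.1.2.2) (i.1.2.2 - i.1.2.1), cf e'.src = ((emlIterU (i.1.2.2 - i.1.2.1) (bgUnits i.1.1 i.1.2.2 U₀) e' : (Matrix (Fin 2) (Fin 2) ℂ)ˣ) : Matrix (Fin 2) (Fin 2) ℂ) * cf e'.tgt *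
        (((emlIterU (i.1.2.2 - i.1.2.1) (bgUnits i.1.1 i.1.2.2 U₀) e')⁻¹ : (Matrix (Fin 2) (Fin 2) ℂ)ˣ) : Matrix (Fin 2) (Fin 2) ℂ)) →
        ∃ l₀ : Site (i.1.1.P i.1.2.2) 0 → Matrix (Fin 2) (Fin 2) ℂ,
        (∀ b' : PBond (i.1.1.P i.1.2.2) 0, l₀ b'.src = ((bgUnits i.1.1 i.1.2.2 U₀ b' : (Matrix (Fin 2) (Fin 2) ℂ)ˣ) : Matrix (Fin 2) (Fin 2) ℂ) * l₀ b'.tgt * (((bgUnits i.1.1 i.1.2.2 U₀ b')⁻¹ : (Matrix (Fin 2) (Fin 2) ℂ)ˣ) : Matrix (Fin 2) (Fin 2) ℂ)) ∧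
        ∀ y : Site (i.1.1.P i.1.2.2) (i.1.2.2 - i.1.2.1), l₀ (embIter (i.1.2.2 - i.1.2.1) y) = cf y) →
      ∀ A : BondL2K ℂ 3 (periodsT3 i.1.1 i.1.2.2) (c₀ L) W₂,
        RS i.1.1 i.1.2.1 i.1.2.2 i.2.2.le (c₀ L) (cB L) U₀ (DstarL2 i.1.1 i.1.2.1 i.1.2.2 (c₀ L) U₀ A) = 0 →
          γ L * ‖A‖ ^ 2 ≤ RCLike.re ⟪A, DeltaEta i.1.1 i.1.2.1 i.1.2.2 (c₀ L) U₀ A⟫_ℂ + a L i * ‖Qk i.1.1 i.1.2.1 i.1.2.2 i.2.2.le (c₀ L) (cB L) U₀ A‖ ^ 2 := by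
  intro L hL i U₀ ρ hreg hρ hlift A hA
  have hFL : (i.1.1.L : ℝ) = (L : ℝ) := by rw [i.2.1]
  have hWε : 10 ^ 12 * (i.1.1.L : ℝ) ^ 3 * αcap L ≤ 1 := by rw [hFL]; exact hWα L hL
  exact gaugeFixedRow_of_curvedTarget (F := i.1.1) (n := i.1.2.1) (K := i.1.2.2) (c₀ := c₀ L) i.2.2.le (cB L) (hαcap L hL) hWε U₀
    (regPr_mono (F := i.1.1) hρ hreg) (hT L hL i U₀ (regPr_mono (F := i.1.1) hρ hreg)) hlift A hA


/-! ## §3 ★★OWNER WORD 63, option (B): the coupling `a` stays a free display letter — the target at the line's coupling `aLOD ≤ a` suffices -/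

/-- ★★ **THE DOOR AT THE DISPLAY'S INDEX WITH A FREE COUPLING (★★OWNER WORD 63, S45 shape (B); the PROVISO's kernel lemma)**: the curved target is MONOTONE in the
coupling (`‖Q_k(U₀)A‖² ≥ 0`), so the (L6) theorem `hT` at the line's own coupling `aLOD L i` serves the display's free letter `a` under the single changed row
`ha : aLOD L i ≤ a L i`; conclusion = the `hGF` binder of S44ᴸγ VERBATIM (as in §2). [cite: Balaban1985BackgroundPropagators, Thm 3.3 p.398, Thm 3.11 p.416] -/
theorem gaugeFixedRow_idx_of_curvedTarget_of_le_coupling (αcap : ℕ → ℝ) (hαcap : ∀ L : ℕ, 1 < L → 0 < αcap L)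
    (hWα : ∀ L : ℕ, 1 < L → 10 ^ 12 * (L : ℝ) ^ 3 * αcap L ≤ 1)
    (c₀ cB : ℕ → ℝ) [hc₀ : ∀ L : ℕ, Fact (0 < c₀ L)] [hcB : ∀ L : ℕ, Fact (0 < cB L)] (aLOD a : ∀ L : ℕ, T3Thm1Carrier.Idx L → ℝ)
    (ha : ∀ (L : ℕ) (i : T3Thm1Carrier.Idx L), aLOD L i ≤ a L i) (γ : ℕ → ℝ)
    (hT : ∀ (L : ℕ), 1 < L → ∀ (i : T3Thm1Carrier.Idx L) (U₀ : GaugeField (i.1.1.P i.1.2.2) 0 (Matrix.specialUnitaryGroup (Fin 2) ℂ)),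
      RegPr i.1.1 i.1.2.1 i.1.2.2 (αcap L) U₀ →
      ∀ (Q'' : SiteL2K ℂ 3 (periodsT3 i.1.1 i.1.2.2) (c₀ L) W₂ →ₗ[ℂ] (Site (i.1.1.P i.1.2.2) (i.1.2.2 - i.1.2.1) → Matrix (Fin 2) (Fin 2) ℂ)),
        (∀ (lam : Site (i.1.1.P i.1.2.2) 0 → Matrix (Fin 2) (Fin 2) ℂ) (ns : (j : ℕ) → Site (i.1.1.P i.1.2.2) j → Matrix (Fin 2) (Fin 2) ℂ), ns 0 = lam →
          (∀ (j : ℕ) (y : Site (i.1.1.P i.1.2.2) (j + 1)), ns (j + 1) y = ns j (emb y) - meanCLM (Idx (i.1.1.P i.1.2.2)) (Matrix (Fin 2) (Fin 2) ℂ) fun ι : Idx (i.1.1.P i.1.2.2) =>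
            ns j (emb y) - ((holT (emlIterU j (bgUnits i.1.1 i.1.2.2 U₀)) (emb y) (stairWord ι.2.1 (off ι.1)) : (Matrix (Fin 2) (Fin 2) ℂ)ˣ) : Matrix (Fin 2) (Fin 2) ℂ) *
              ns j (transl (emb y) (disp (stairWord ι.2.1 (off ι.1)))) * (((holT (emlIterU j (bgUnits i.1.1 i.1.2.2 U₀)) (emb y) (stairWord ι.2.1 (off ι.1)))⁻¹ : (Matrix (Fin 2) (Fin 2) ℂ)ˣ) : Matrix (Fin 2) (Fin 2) ℂ)) →
          ns (i.1.2.2 - i.1.2.1) = Q'' (toL2S i.1.1 i.1.2.2 (c₀ L) lam)) →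
        LinearMap.ker Q'' ≤ NS i.1.1 i.1.2.1 i.1.2.2 i.2.2.le (c₀ L) (cB L) U₀ →
        ∀ A : BondL2K ℂ 3 (periodsT3 i.1.1 i.1.2.2) (c₀ L) W₂,
          γ L * ‖A‖ ^ 2 ≤ RCLike.re ⟪A, DeltaEta i.1.1 i.1.2.1 i.1.2.2 (c₀ L) U₀ A⟫_ℂ
            + ‖projR (covLapSite i.1.1 i.1.2.1 i.1.2.2 (c₀ L) U₀) Q'' (DstarL2 i.1.1 i.1.2.1 i.1.2.2 (c₀ L) U₀ A)‖ ^ 2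
            + aLOD L i * ‖Qk i.1.1 i.1.2.1 i.1.2.2 i.2.2.le (c₀ L) (cB L) U₀ A‖ ^ 2) :
    ∀ (L : ℕ), 1 < L → ∀ (i : T3Thm1Carrier.Idx L) (U₀ : GaugeField (i.1.1.P i.1.2.2) 0 (Matrix.specialUnitaryGroup (Fin 2) ℂ)), ∀ ρ : ℝ, RegPr i.1.1 i.1.2.1 i.1.2.2 ρ U₀ → ρ ≤ αcap L →
        (∀ cf : Site (i.1.1.P i.1.2.2) (i.1.2.2 - i.1.2.1) → Matrix (Fin 2) (Fin 2) ℂ,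
        (∀ e' : PBond (i.1.1.P i.1.2.2) (i.1.2.2 - i.1.2.1), cf e'.src = ((emlIterU (i.1.2.2 - i.1.2.1) (bgUnits i.1.1 i.1.2.2 U₀) e' : (Matrix (Fin 2) (Fin 2) ℂ)ˣ) : Matrix (Fin 2) (Fin 2) ℂ) * cf e'.tgt *
        (((emlIterU (i.1.2.2 - i.1.2.1) (bgUnits i.1.1 i.1.2.2 U₀) e')⁻¹ : (Matrix (Fin 2) (Fin 2) ℂ)ˣ) : Matrix (Fin 2) (Fin 2) ℂ)) →
        ∃ l₀ : Site (i.1.1.P i.1.2.2) 0 → Matrix (Fin 2) (Fin 2) ℂ,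
        (∀ b' : PBond (i.1.1.P i.1.2.2) 0, l₀ b'.src = ((bgUnits i.1.1 i.1.2.2 U₀ b' : (Matrix (Fin 2) (Fin 2) ℂ)ˣ) : Matrix (Fin 2) (Fin 2) ℂ) * l₀ b'.tgt * (((bgUnits i.1.1 i.1.2.2 U₀ b')⁻¹ : (Matrix (Fin 2) (Fin 2) ℂ)ˣ) : Matrix (Fin 2) (Fin 2) ℂ)) ∧
        ∀ y : Site (i.1.1.P i.1.2.2) (i.1.2.2 - i.1.2.1), l₀ (embIter (i.1.2.2 - i.1.2.1) y) = cf y) →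
      ∀ A : BondL2K ℂ 3 (periodsT3 i.1.1 i.1.2.2) (c₀ L) W₂,
        RS i.1.1 i.1.2.1 i.1.2.2 i.2.2.le (c₀ L) (cB L) U₀ (DstarL2 i.1.1 i.1.2.1 i.1.2.2 (c₀ L) U₀ A) = 0 →
          γ L * ‖A‖ ^ 2 ≤ RCLike.re ⟪A, DeltaEta i.1.1 i.1.2.1 i.1.2.2 (c₀ L) U₀ A⟫_ℂ + a L i * ‖Qk i.1.1 i.1.2.1 i.1.2.2 i.2.2.le (c₀ L) (cB L) U₀ A‖ ^ 2 := by
  intro L hL i U₀ ρ hreg hρ hlift A hA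
  have h1 := gaugeFixedRow_idx_of_curvedTarget αcap hαcap hWα c₀ cB aLOD γ hT L hL i U₀ ρ hreg hρ hlift A hA
  have h2 : aLOD L i * ‖Qk i.1.1 i.1.2.1 i.1.2.2 i.2.2.le (c₀ L) (cB L) U₀ A‖ ^ 2 ≤ a L i * ‖Qk i.1.1 i.1.2.1 i.1.2.2 i.2.2.le (c₀ L) (cB L) U₀ A‖ ^ 2 :=
    mul_le_mul_of_nonneg_right (ha L i) (sq_nonneg _)
  linarith

end Summit.QuantumFields.YangMills.Theorems.Prop7GaugeFixedRowDoorOfLODTarget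

end
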